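import Summits.Ventures.HodgeRepro2.T5SU11RadialGreenImproperOrigin
import Summits.Ventures.HodgeRepro2.T5SU11KernelCompositionODE
import Summits.Ventures.HodgeRepro2.T5SU11SphericalDeriv

/-!
# The resolvent and the composed kernels at the origin: `G^I_λ g(t) → −∫_0^∞ χ_λ g sinh 2s ds` as `t → 0⁺`, and the
Neumann condition of the kernel

Row 493 showed that `G^I_λ g = −χ_λ B^I − φ_λ A^I` is bounded at the origin (`χ_λ B^I → 0`, `A^I` bounded). The limit exists:
`A^I(t) = ∫_{(0,∞)} χ_λ g sinh − ∫_{(0,t]} χ_λ g sinh` and the second integral tends to `0` (dominated convergence), while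
`φ_λ(a_t) → 1`. Hence

* `tendsto_setIntegral_Ioc_nhdsGT_zero` — `∫_{(0,t]} h → 0` as `t → 0⁺` for `h ∈ L¹(0, ∞)`;
* `tendsto_greenAI_nhdsGT_zero`, `tendsto_greenSolI_nhdsGT_zero` — **`G^I_λ g(t) → −∫_{(0,∞)} χ_λ(s) g(s) sinh 2s ds`** as
  `t → 0⁺`, for every source bounded on `(0, 1]` and integrable against the basis: the value of the resolvent at the origin
  is the `χ_λ`-transform of the source;
* `tendsto_kernel_comp_nhdsGT_zero` — **`K_λ^{∘(n+2)}(t, s) → −∫_{(0,∞)} χ_λ(r) K_λ^{∘(n+1)}(r, s) sinh 2r dr`** as `t → 0⁺`;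
* `hasDerivWithinAt_kernel_zero` — **the Neumann condition `∂_t K_λ(0⁺, s) = 0`** (`K_λ(·, s) = −χ_λ(s) φ_λ` on `[0, s]` and
  `φ_λ′(0) = 0`, row 3xx).

Nothing is claimed about (N).

Blind lane: Mathlib + the HodgeRepro2 prefix only; no sorry; axioms ⊆ {propext, Classical.choice,
Quot.sound}.
-/

namespace Summit.Ventures.HodgeRepro2.T5SU11ResolventOrigin

open Filter Topology MeasureTheory
open Set (Ioi Ioc Ici)
open T5SU11Cartan T5SU11SphericalFunction T5SU11SphericalBounds T5SU11SphericalContinuous T5SU11SphericalDecay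
  T5SU11SphericalSolutionSpaceAll T5SU11SphericalDeriv T5SU11RadialGreenKernel T5SU11RadialGreenImproper
  T5SU11RadialGreenImproperOrigin T5SU11KernelCompositionODE

/-- **`∫_{(0,t]} h → 0` as `t → 0⁺`** for an integrable `h` on `(0, ∞)` (dominated convergence with the bound `|h|`). -/
theorem tendsto_setIntegral_Ioc_nhdsGT_zero {h : ℝ → ℝ} (hint : IntegrableOn h (Ioi 0)) :
    Tendsto (fun t => ∫ s in Ioc 0 t, h s) (𝓝[>] 0) (𝓝 0) := by
  have e : ∀ t : ℝ, ∫ s in Ioc 0 t, h s = ∫ s, Set.indicator (Ioc 0 t) h s ∂(volume.restrict (Ioi (0 : ℝ))) := by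
    intro t
    have hset : Ioc (0 : ℝ) t ∩ Ioi 0 = Ioc 0 t := Set.inter_eq_left.mpr (fun s hs => hs.1)
    rw [integral_indicator measurableSet_Ioc, Measure.restrict_restrict measurableSet_Ioc, hset]
  simp_rw [e]
  have key : Tendsto (fun t => ∫ s, Set.indicator (Ioc 0 t) h s ∂(volume.restrict (Ioi (0 : ℝ)))) (𝓝[>] (0 : ℝ))
      (𝓝 (∫ s : ℝ, (0 : ℝ) ∂(volume.restrict (Ioi (0 : ℝ))))) := by
    refine tendsto_integral_filter_of_dominated_convergence (fun s => |h s|) ?_ ?_ hint.abs ?_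
    · exact Eventually.of_forall fun t => (hint.aestronglyMeasurable.indicator measurableSet_Ioc)
    · refine Eventually.of_forall fun t => ae_of_all _ fun s => ?_
      rw [Real.norm_eq_abs]
      by_cases hm : s ∈ Ioc 0 t
      · rw [Set.indicator_of_mem hm]
      · rw [Set.indicator_of_notMem hm, abs_zero]
        exact abs_nonneg _
    · refine ae_restrict_of_forall_mem measurableSet_Ioi fun s hs => ?_
      have hs' : (0 : ℝ) < s := hs
      have hev : ∀ᶠ t in 𝓝[>] (0 : ℝ), Set.indicator (Ioc 0 t) h s = 0 := by
        filter_upwards [Ioo_mem_nhdsGT hs'] with t ht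
        exact Set.indicator_of_notMem (fun hm => absurd hm.2 (not_le.mpr ht.2)) _
      exact tendsto_const_nhds.congr' (hev.mono fun t ht => ht.symm)
  simpa using key

section measure

variable [MeasurableSpace Circle] [BorelSpace Circle]

variable {lam : ℝ} (hlam : 1 < lam) {g : ℝ → ℝ} (hg : ContinuousOn g (Ioi 0))
  {M : ℝ} (hM : ∀ s ∈ Ioc (0 : ℝ) 1, |g s| ≤ M) (hM0 : 0 ≤ M)
  (hA : IntegrableOn (fun s => sphDecay lam s * g s * Real.sinh (2 * s)) (Ioi 0))

omit [BorelSpace Circle] in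
include hA in
/-- **`A^I(t) → ∫_{(0,∞)} χ_λ g sinh 2s ds`** as `t → 0⁺`. -/
theorem tendsto_greenAI_nhdsGT_zero :
    Tendsto (greenAI (sphDecay lam) g) (𝓝[>] 0) (𝓝 (∫ s in Ioi 0, sphDecay lam s * g s * Real.sinh (2 * s))) := by
  have h := (tendsto_const_nhds (x := ∫ s in Ioi 0, sphDecay lam s * g s * Real.sinh (2 * s))).sub
    (tendsto_setIntegral_Ioc_nhdsGT_zero hA)
  rw [sub_zero] at h
  refine h.congr' ?_
  filter_upwards [self_mem_nhdsWithin] with t ht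
  exact (greenAI_eq hA ht).symm

include hlam hM hM0 hA in
/-- **THE RESOLVENT AT THE ORIGIN**: `G^I_λ g(t) → −∫_{(0,∞)} χ_λ(s) g(s) sinh 2s ds` as `t → 0⁺`. -/
theorem tendsto_greenSolI_nhdsGT_zero :
    Tendsto (greenSolI (fun t => sph lam (hyp t)) (sphDecay lam) g) (𝓝[>] 0)
      (𝓝 (-∫ s in Ioi 0, sphDecay lam s * g s * Real.sinh (2 * s))) := by
  have h1 := tendsto_sphDecay_mul_greenBI hlam hM hM0 (g := g)
  have hφ : Tendsto (fun t => sph lam (hyp t)) (𝓝[>] 0) (𝓝 1) := by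
    have h : Tendsto (fun t => sph lam (hyp t)) (𝓝[>] 0) (𝓝 (sph lam (hyp 0))) :=
      ((continuous_sph_hyp lam).tendsto 0).mono_left (nhdsWithin_le_nhds (s := Ioi 0))
    rwa [T5SU11OneParameter.hyp_zero, sph_one] at h
  have h2 := hφ.mul (tendsto_greenAI_nhdsGT_zero hA)
  rw [one_mul] at h2
  have h := (h1.neg).sub h2
  rw [neg_zero, zero_sub] at h
  exact h

include hlam in
/-- **The composed kernels at the origin**: `K_λ^{∘(n+2)}(t, s) → −∫_{(0,∞)} χ_λ(r) K_λ^{∘(n+1)}(r, s) sinh 2r dr` as `t → 0⁺`. -/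
theorem tendsto_kernel_comp_nhdsGT_zero {s : ℝ} (hs : 0 < s) (n : ℕ) :
    Tendsto (fun t => ((greenSolI (fun t => sph lam (hyp t)) (sphDecay lam))^[n + 1] (fun r => sphGreenKernel lam r s)) t)
      (𝓝[>] 0)
      (𝓝 (-∫ r in Ioi 0, sphDecay lam r
        * ((greenSolI (fun t => sph lam (hyp t)) (sphDecay lam))^[n] (fun r => sphGreenKernel lam r s)) r
        * Real.sinh (2 * r))) := by
  obtain ⟨hc, hB, hA⟩ := kernel_comp_basis_integrable hlam hs n
  -- the source is bounded on `(0, 1]` (row 503's class data)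
  obtain ⟨Ms, hMs0, hMs⟩ := T5SU11KernelDifferenceRegularity.kernel_source_bounded hlam hs
  obtain ⟨Cs, s₀, hCs⟩ := T5SU11KernelDifferenceRegularity.kernel_source_decay hlam hs
  have hks := T5SU11KernelDifferenceRegularity.kernel_source_continuousOn hlam hs
  have hεk : 2 - lam < lam := by linarith
  obtain ⟨_, ⟨Mn, hMn0, hMn⟩, _⟩ :=
    T5SU11ResolventNeumann.iterate_class (lam₂ := lam) hlam hks hMs hMs0 hεk hCs n
  have h := tendsto_greenSolI_nhdsGT_zero hlam hMn hMn0 hA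
  refine h.congr' (Eventually.of_forall fun t => ?_)
  rw [Function.iterate_succ_apply']

/-- **The Neumann condition of the kernel at the origin**: the derivative of `t ↦ K_λ(t, s)` at `t = 0` (from the right) vanishes,
for every `s > 0` (`K_λ(·, s) = −χ_λ(s) φ_λ` on `[0, s]` and `φ_λ′(0) = 0`). -/
theorem hasDerivWithinAt_kernel_zero (lam : ℝ) {s : ℝ} (hs : 0 < s) :
    HasDerivWithinAt (fun t => sphGreenKernel lam t s) 0 (Ici 0) 0 := by
  have h := ((hasDerivAt_sph_hyp_deriv lam 0).const_mul (sphDecay lam s)).neg.hasDerivWithinAt (s := Set.Icc 0 s)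
  rw [deriv_sph_hyp_zero, mul_zero, neg_zero] at h
  have h' : HasDerivWithinAt (fun t => sphGreenKernel lam t s) 0 (Set.Icc 0 s) 0 := by
    refine h.congr_of_mem ?_ (Set.left_mem_Icc.mpr hs.le)
    intro t ht
    unfold sphGreenKernel
    rw [greenKernel_of_ge _ _ ht.2]
    simp only [Pi.neg_apply]
    ring
  exact h'.mono_of_mem_nhdsWithin (Icc_mem_nhdsGE hs)

end measure

end Summit.Ventures.HodgeRepro2.T5SU11ResolventOrigin
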